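import Literature.NumberTheory.ConnesConsani2021.ArchKernelTier2Panels
import HarnessLib

/-!
# (E-a) Tier 2 — kernel reproduction of the panel data in FLAT form, group 8 (coarse panels 32..35)

RH-FREE certified-numerics plumbing (cell rh-crit, seat rh-crit-cc-iso g4).  Same computation as
`ArchKernelTier2PanelsCheck8.lean`, but each equality is stated MATCH-FREE and one panel per theorem —
`subSups (tsubI (sigmaTM K) ((s8TM hQ 6 (centre K) combinedLit).getD [])) = panelM[K]` — which is the exact shape the
read-back `ArchCertT2.hM_of_subSups` / `tier2_hM_of` (T2d soundness) consumes by `exact`, with no definitional unfolding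
of the certificate data in any later proof (rewriting under the `match` of `panelSups` makes the kernel unfold the data:
«deep recursion»).  `decide +kernel` only (≈ 4 × 30 s), standard axioms.
WHAT THIS IS NOT: a statement about the prolate functions or about RH; nothing here bears on the truth of RH.
-/

open Literature.Analysis.ValidatedNumerics.PolyMP
open Literature.NumberTheory.ConnesConsani2021.ArchCertSigma (sigmaTM hQ)

namespace Literature.NumberTheory.ConnesConsani2021.ArchCertT2

set_option maxRecDepth 200000 in
/-- **Flat panel fact 32**: the kernel's 32 sub-panel sups of `sigmaTM 32 − s8TM` ARE row 32 of `panelM`. [cite: ConnesConsani2021, §6.4 Fact 6.1 + Lemma 6.3 p. 24 (in-kernel (E-a) certificate); §6.3 p. 24] -/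
theorem panelFlat_32 :
    subSups (tsubI (sigmaTM 32) ((s8TM hQ 6 (centre 32) combinedLit).getD [])) = panelM.getD 32 [] := by
  decide +kernel

set_option maxRecDepth 200000 in
/-- **Flat panel fact 33**: the kernel's 32 sub-panel sups of `sigmaTM 33 − s8TM` ARE row 33 of `panelM`. [cite: ConnesConsani2021, §6.4 Fact 6.1 + Lemma 6.3 p. 24 (in-kernel (E-a) certificate); §6.3 p. 24] -/
theorem panelFlat_33 :
    subSups (tsubI (sigmaTM 33) ((s8TM hQ 6 (centre 33) combinedLit).getD [])) = panelM.getD 33 [] := by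
  decide +kernel

set_option maxRecDepth 200000 in
/-- **Flat panel fact 34**: the kernel's 32 sub-panel sups of `sigmaTM 34 − s8TM` ARE row 34 of `panelM`. [cite: ConnesConsani2021, §6.4 Fact 6.1 + Lemma 6.3 p. 24 (in-kernel (E-a) certificate); §6.3 p. 24] -/
theorem panelFlat_34 :
    subSups (tsubI (sigmaTM 34) ((s8TM hQ 6 (centre 34) combinedLit).getD [])) = panelM.getD 34 [] := by
  decide +kernel

set_option maxRecDepth 200000 in
/-- **Flat panel fact 35**: the kernel's 32 sub-panel sups of `sigmaTM 35 − s8TM` ARE row 35 of `panelM`. [cite: ConnesConsani2021, §6.4 Fact 6.1 + Lemma 6.3 p. 24 (in-kernel (E-a) certificate); §6.3 p. 24] -/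
theorem panelFlat_35 :
    subSups (tsubI (sigmaTM 35) ((s8TM hQ 6 (centre 35) combinedLit).getD [])) = panelM.getD 35 [] := by
  decide +kernel

end Literature.NumberTheory.ConnesConsani2021.ArchCertT2
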